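import Summits.QuantumFields.BalabanUV.T4Continuum.Support.NE7EffectiveFormLowerBoundFinal
import Summits.QuantumFields.BalabanUV.T4Continuum.Support.NE3ClassSlicePoincare
import HarnessLib

/-!
# NE7EffectiveFormLowerBoundSU2 — (G′) FOR SU(2) AND SU(3) AT d = 4, L = 2 WITH NO NUMERIC HYPOTHESIS LEFT: `∃ ε₀ > 0, ∀ 0 < ε < ε₀, ∀ N ≥ 1, ∀ j, ∃ δV > 0, …` (lineage
# `b2b-balaban-t4-ne7-p1`, gen 119, file H18)

Cell `pub-balaban`, rung (B)+1 sub-cell t4, CRUX PROVER NE7 #1 (OWNER of row NE7), generation 119.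
WHY.  ✓ H17 `NE7EffectiveFormLowerBoundFinal.effectiveForm_lower_bound_final` is (G′) with only the four K-road lines of row NE3's class slice Poincaré inequality in the auxiliary
parameters `(τ, ε_c)` displayed; row NE3 VERIFIED those lines numerically at `d = 4`, `L = 2`, `card n = 2` and `card n = 3` with `ε_c = 10⁻¹⁷`, `τ = 10⁻⁵³`
(✓ `NE3ClassSlicePoincare.lines_d4_L2_c2`, `lines_d4_L2_c3`).  THIS FILE plugs them in: (G′) for the SU(2) and SU(3) models at block size `L = 2` with NO numeric hypothesis at all.
WHAT ([folklore]; 0 def, 0 sorry): **`effectiveForm_lower_bound_SU2_L2`**, **`effectiveForm_lower_bound_SU3_L2`**.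
HONEST FRAMING (page 1): (G′) is row NE7's binder target about OUR lattice objects in the lineage's all-data frame («∃ δV ∀ V₀ δV-small»; `ε₀` not computed); NOT Bałaban's NE7 as
printed, NOT a spine node by itself (spine 0∕9 until the NE7 record consumes it); nothing of Bałaban's asserted; finite T⁴ rung (B)+1 — NOT continuum YM on ℝ⁴, NOT infinite volume,
NOT mass gap, NOT BetaPertH, NOT Clay.
-/

set_option autoImplicit false

open scoped BigOperators Matrix Matrix.Norms.L2Operator Topology
open NormedSpace Finset Set Filter Metric

namespace Summit.QuantumFields.BalabanUV.T4Continuum.NE7EffectiveFormLowerBoundSU2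

open Literature.MathematicalPhysics.QuantumFieldTheory.Balaban1983to89
open B7Prop1Explicit B7Prop2Explicit MatrixLog UnitaryModel
open T4AveragingDeficitWall (IsUnitaryCfg IsSkewDir SmallField Ad curl curlAt curlSq dirSq dirL1 fineAction)
open T4AveragingDeficitWallBoundary (IsPeriodicCfg periodBox)
open AveragingDeficitTorusChart (TDir chart chartDir resDir extDir)
open AveragingDeficitTwoLevelPrep (twoLevelSmall skewSub skewPR)
open AveragingDeficitMultiLevelPrep (cavgIter tower levelQ levelQ' LevelSmall tower_ne_zero)
open MatrixNorms (nhsNormSq)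
open MinimalActionLevels (perWin stepWt)
open MinimalActionSandwich (IsMinimiser minAct)
open MinimalActionRate (sfClass)
open NE7RadIterUniform (radD)
open NE7StraightTowerCurlEnergy (eC mC)
open NE3QbarIterCovLiftPrep (cruxC)
open NE3RightInverseSolveLetters (thetaLoc)
open NE7SliceRepHessianFloor (liftMassC liftCurlC)
open NE3HatInvCurlLetters (curl1C)
open BlockAverageVaryHolo (nbRad)
open NE3CovariantLineSumsError (Csup)
open NE3CovariantLineSumsL2 (C2sq)
open NE3CovariantLineSumsL2Tower (rho)
open ShellMeasureAverageProp4General (C1cov)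
open NE3SlicePoincareBudgetLine (ShLine SmallYLine CPLine)
open NE7EffectiveFormLowerBoundFinal (effectiveForm_lower_bound_final)
open NE3ClassSlicePoincare (lines_d4_L2_c2 lines_d4_L2_c3)

noncomputable section

variable {n : Type} [Fintype n] [DecidableEq n]

/-- **(G′) FOR SU(2) AT d = 4, L = 2, NO NUMERIC HYPOTHESIS** (`C_P = CPLine 4 2 2 10⁻¹⁷ 10⁻⁵³ ≤ 1234·10¹⁴`). [folklore] -/
theorem effectiveForm_lower_bound_SU2_L2 [Nonempty n] (hn : Fintype.card n = 2) :
    ∃ ε₀ : ℝ, 0 < ε₀ ∧ ∀ ε : ℝ, 0 < ε → ε < ε₀ →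
      ∀ (N : ℕ) [NeZero N], 1 ≤ N → ∀ j : ℕ,
      ∃ δV : ℝ, 0 < δV ∧
        ∀ V₀ ∈ {V : Site 4 → Fin 4 → (Matrix n n ℂ)ˣ | IsUnitaryCfg V ∧ IsPeriodicCfg V (N : ℤ) ∧ SmallField V δV},
        ∀ Us : Site 4 → Fin 4 → (Matrix n n ℂ)ˣ, IsMinimiser 4 (sfClass 4 2 N ε) 2 N (j + 1) V₀ Us → ∀ θ : ℝ, 0 < θ →
        ∀ v : ↥(skewSub 4 n N),
          (1 - (2 * curl1C 4 2 * ε * (128 * (C1cov 4 * ((2 : ℕ) : ℝ) ^ 2 * (4 * (4 * ((2 : ℕ) : ℝ) + 1) ^ 4)) * ((2 : ℕ) : ℝ) ^ 2)) * (2 * (4 * CPLine 4 2 (Fintype.card n) (1 / 10 ^ 17) (1 / 10 ^ 53) * Fintype.card n)))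
              * (((stepWt 4 2)⁻¹) ^ (j + 1) * ∑ P ∈ perWin 4 N, nhsNormSq (curl V₀ (chartDir (ContinuousLinearMap.id ℝ (Matrix n n ℂ)) N (v : TDir 4 n N)) P))
            ≤ ((1 + θ) + 2 * ((1 + θ) * (14 * (Fintype.card (T4AveragingDeficitWall.Plane 4) : ℝ) * ε) + (1 + θ⁻¹) * (36 * eC 4 2 (Fintype.card n) ^ 2 * ε ^ 2))
                    * (4 * CPLine 4 2 (Fintype.card n) (1 / 10 ^ 17) (1 / 10 ^ 53) * Fintype.card n))
                * fderiv ℝ (fderiv ℝ (fun y : ↥(skewSub 4 n N) => minAct 4 (sfClass 4 2 N ε) 2 N (j + 1) (chart (ContinuousLinearMap.id ℝ (Matrix n n ℂ)) N V₀ (y : TDir 4 n N)))) 0 v v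
              + ((stepWt 4 2)⁻¹) ^ (j + 1)
                * (2 * (((1 + θ) + 2 * ((1 + θ) * (14 * (Fintype.card (T4AveragingDeficitWall.Plane 4) : ℝ) * ε) + (1 + θ⁻¹) * (36 * eC 4 2 (Fintype.card n) ^ 2 * ε ^ 2))
                        * (4 * CPLine 4 2 (Fintype.card n) (1 / 10 ^ 17) (1 / 10 ^ 53) * Fintype.card n)))
                      * (2 * curl1C 4 2 * ε * (128 * (C1cov 4 * ((2 : ℕ) : ℝ) ^ 2 * (4 * (4 * ((2 : ℕ) : ℝ) + 1) ^ 4)) * ((2 : ℕ) : ℝ) ^ 2)) * (2 * liftMassC 4 2 + 4 * CPLine 4 2 (Fintype.card n) (1 / 10 ^ 17) (1 / 10 ^ 53) * liftCurlC 4 2)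
                    + (1 - (2 * curl1C 4 2 * ε * (128 * (C1cov 4 * ((2 : ℕ) : ℝ) ^ 2 * (4 * (4 * ((2 : ℕ) : ℝ) + 1) ^ 4)) * ((2 : ℕ) : ℝ) ^ 2)) * (2 * (4 * CPLine 4 2 (Fintype.card n) (1 / 10 ^ 17) (1 / 10 ^ 53) * Fintype.card n)))
                      * (2 * ((1 + θ) * (14 * (Fintype.card (T4AveragingDeficitWall.Plane 4) : ℝ) * ε) + (1 + θ⁻¹) * (36 * eC 4 2 (Fintype.card n) ^ 2 * ε ^ 2))
                        * (2 * liftMassC 4 2 + 4 * CPLine 4 2 (Fintype.card n) (1 / 10 ^ 17) (1 / 10 ^ 53) * liftCurlC 4 2)))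
                * dirSq (chartDir (ContinuousLinearMap.id ℝ (Matrix n n ℂ)) N (v : TDir 4 n N)) (periodBox N) := by
  obtain ⟨h1, h2, h3, h4, -⟩ := lines_d4_L2_c2
  have h1' : ShLine 4 2 (Fintype.card n) (1 / 10 ^ 17) (1 / 10 ^ 53) ≤ 1 / 2 := by rw [hn]; exact h1
  have h2' : SmallYLine 4 2 (Fintype.card n) (1 / 10 ^ 17) (1 / 10 ^ 53) ≤ 1 / 2 := by rw [hn]; exact h2
  have h4' : 8 * ((4 : ℕ) : ℝ) * ((((4 : ℕ) : ℝ) - 1) * (1 / 10 ^ 53 : ℝ)) ^ 2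
      + 2 * ((Fintype.card n : ℝ) * ((4 * ((4 : ℕ) : ℝ) ^ 2 + 272 * ((4 : ℕ) : ℝ) * ((((4 : ℕ) : ℝ) + 1) * (((4 : ℕ) : ℝ) + 4))) * (1 / 10 ^ 53 : ℝ)) ^ 2) ≤ 1 / 2 := by
    rw [hn]; exact h4
  exact effectiveForm_lower_bound_final (n := n) (L := 2) (by norm_num) (by norm_num) (by norm_num) h1' h2' h3 h4'

/-- **(G′) FOR SU(3) AT d = 4, L = 2, NO NUMERIC HYPOTHESIS** (`C_P = CPLine 4 2 3 10⁻¹⁷ 10⁻⁵³`). [folklore] -/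
theorem effectiveForm_lower_bound_SU3_L2 [Nonempty n] (hn : Fintype.card n = 3) :
    ∃ ε₀ : ℝ, 0 < ε₀ ∧ ∀ ε : ℝ, 0 < ε → ε < ε₀ →
      ∀ (N : ℕ) [NeZero N], 1 ≤ N → ∀ j : ℕ,
      ∃ δV : ℝ, 0 < δV ∧
        ∀ V₀ ∈ {V : Site 4 → Fin 4 → (Matrix n n ℂ)ˣ | IsUnitaryCfg V ∧ IsPeriodicCfg V (N : ℤ) ∧ SmallField V δV},
        ∀ Us : Site 4 → Fin 4 → (Matrix n n ℂ)ˣ, IsMinimiser 4 (sfClass 4 2 N ε) 2 N (j + 1) V₀ Us → ∀ θ : ℝ, 0 < θ →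
        ∀ v : ↥(skewSub 4 n N),
          (1 - (2 * curl1C 4 2 * ε * (128 * (C1cov 4 * ((2 : ℕ) : ℝ) ^ 2 * (4 * (4 * ((2 : ℕ) : ℝ) + 1) ^ 4)) * ((2 : ℕ) : ℝ) ^ 2)) * (2 * (4 * CPLine 4 2 (Fintype.card n) (1 / 10 ^ 17) (1 / 10 ^ 53) * Fintype.card n)))
              * (((stepWt 4 2)⁻¹) ^ (j + 1) * ∑ P ∈ perWin 4 N, nhsNormSq (curl V₀ (chartDir (ContinuousLinearMap.id ℝ (Matrix n n ℂ)) N (v : TDir 4 n N)) P))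
            ≤ ((1 + θ) + 2 * ((1 + θ) * (14 * (Fintype.card (T4AveragingDeficitWall.Plane 4) : ℝ) * ε) + (1 + θ⁻¹) * (36 * eC 4 2 (Fintype.card n) ^ 2 * ε ^ 2))
                    * (4 * CPLine 4 2 (Fintype.card n) (1 / 10 ^ 17) (1 / 10 ^ 53) * Fintype.card n))
                * fderiv ℝ (fderiv ℝ (fun y : ↥(skewSub 4 n N) => minAct 4 (sfClass 4 2 N ε) 2 N (j + 1) (chart (ContinuousLinearMap.id ℝ (Matrix n n ℂ)) N V₀ (y : TDir 4 n N)))) 0 v v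
              + ((stepWt 4 2)⁻¹) ^ (j + 1)
                * (2 * (((1 + θ) + 2 * ((1 + θ) * (14 * (Fintype.card (T4AveragingDeficitWall.Plane 4) : ℝ) * ε) + (1 + θ⁻¹) * (36 * eC 4 2 (Fintype.card n) ^ 2 * ε ^ 2))
                        * (4 * CPLine 4 2 (Fintype.card n) (1 / 10 ^ 17) (1 / 10 ^ 53) * Fintype.card n)))
                      * (2 * curl1C 4 2 * ε * (128 * (C1cov 4 * ((2 : ℕ) : ℝ) ^ 2 * (4 * (4 * ((2 : ℕ) : ℝ) + 1) ^ 4)) * ((2 : ℕ) : ℝ) ^ 2)) * (2 * liftMassC 4 2 + 4 * CPLine 4 2 (Fintype.card n) (1 / 10 ^ 17) (1 / 10 ^ 53) * liftCurlC 4 2)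
                    + (1 - (2 * curl1C 4 2 * ε * (128 * (C1cov 4 * ((2 : ℕ) : ℝ) ^ 2 * (4 * (4 * ((2 : ℕ) : ℝ) + 1) ^ 4)) * ((2 : ℕ) : ℝ) ^ 2)) * (2 * (4 * CPLine 4 2 (Fintype.card n) (1 / 10 ^ 17) (1 / 10 ^ 53) * Fintype.card n)))
                      * (2 * ((1 + θ) * (14 * (Fintype.card (T4AveragingDeficitWall.Plane 4) : ℝ) * ε) + (1 + θ⁻¹) * (36 * eC 4 2 (Fintype.card n) ^ 2 * ε ^ 2))
                        * (2 * liftMassC 4 2 + 4 * CPLine 4 2 (Fintype.card n) (1 / 10 ^ 17) (1 / 10 ^ 53) * liftCurlC 4 2)))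
                * dirSq (chartDir (ContinuousLinearMap.id ℝ (Matrix n n ℂ)) N (v : TDir 4 n N)) (periodBox N) := by
  obtain ⟨-, -, h3, -, -⟩ := lines_d4_L2_c2
  obtain ⟨h1, h2, h4, -⟩ := lines_d4_L2_c3
  have h1' : ShLine 4 2 (Fintype.card n) (1 / 10 ^ 17) (1 / 10 ^ 53) ≤ 1 / 2 := by rw [hn]; exact h1
  have h2' : SmallYLine 4 2 (Fintype.card n) (1 / 10 ^ 17) (1 / 10 ^ 53) ≤ 1 / 2 := by rw [hn]; exact h2
  have h4' : 8 * ((4 : ℕ) : ℝ) * ((((4 : ℕ) : ℝ) - 1) * (1 / 10 ^ 53 : ℝ)) ^ 2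
      + 2 * ((Fintype.card n : ℝ) * ((4 * ((4 : ℕ) : ℝ) ^ 2 + 272 * ((4 : ℕ) : ℝ) * ((((4 : ℕ) : ℝ) + 1) * (((4 : ℕ) : ℝ) + 4))) * (1 / 10 ^ 53 : ℝ)) ^ 2) ≤ 1 / 2 := by
    rw [hn]; exact h4
  exact effectiveForm_lower_bound_final (n := n) (L := 2) (by norm_num) (by norm_num) (by norm_num) h1' h2' h3 h4'

end

end Summit.QuantumFields.BalabanUV.T4Continuum.NE7EffectiveFormLowerBoundSU2
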